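import Mathlib
import Summits.PneNP.PneNP.Theorems.OverlapGapAlgebraSolvableImpliesStableSectionMonotoneRepairTreeAsm

/-!
# PneNP / OverlapGapAlgebra — crux `SolvableImpliesStableSection` (stmt-PneNP-2463):
# the MONOTONE REPAIR block (5/·) — tree codes: validity of an assembled code from its subtrees

Support for crux `stmt-PneNP-2463` (`Summit.PneNP.PneNP.Theses.OverlapGapAlgebra.SolvableImpliesStableSection`):
the f-free block "bounded-round monotone repair gives stable sections up to `α ≤ 2^k/(4k)`".
Two predicates on a tree code `T` (a finite set of labelled addresses, `…MonotoneRepairTreeAsm`):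
* SYNTACTIC VALIDITY in an instance `Φ`: at every node `(a, (x, r))` and slot `j`, the sign of
  `(x, j)` is positive iff a child hangs at `j :: a`, and the variable of `(x, j)` equals the variable of
  the least childless slot of that child's clause;
* LOCAL VALIDITY (instance-free): children have smaller rounds and a childless slot, and every node of
  round `≥ 1` has a child of the preceding round — or is a root all of whose slots have children.
This file transports both predicates (and "the root has a childless slot") through the assembling
operation `asm`:

* `sissR_synv_asm` — syntactic validity of `asm c r ch` from that of the subtrees plus the root's
  sign pattern and edge equations;
* `sissR_locv_asm_of` — local validity of `asm c r ch` from that of the subtrees (with childless root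
  slots and smaller rounds) plus recency-or-fullness at the root;
* `sissR_locv_asm_imp` — conversely, local validity of `asm c r ch` gives local validity, a childless
  root slot and a smaller round for every subtree, and recency-or-fullness at the root;
* `sissR_hasNone_asm` — the root of `asm c r ch` has a childless slot iff some `ch j = none`.
No definitions (all objects are hypotheses); axioms `propext`, `Classical.choice`, `Quot.sound`.
-/

set_option linter.dupNamespace false -- `Summit.PneNP.PneNP.…`: summit = sub-problem (D-0017)

namespace Summit.PneNP.PneNP.Theorems

open Finset
open scoped Classical

section TreeCompose

variable {m k n : ℕ}

/-- Every element of an assembled code is the root or a shifted element of a subtree. -/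
theorem sissR_asm_cases (asm : Fin m → ℕ → (Fin k → Option (Finset (List (Fin k) × (Fin m × ℕ)))) → Finset (List (Fin k) × (Fin m × ℕ)))
    (hasm : ∀ (c : Fin m) (r : ℕ) (ch : Fin k → Option (Finset (List (Fin k) × (Fin m × ℕ))))
      (e : (List (Fin k) × (Fin m × ℕ))), e ∈ asm c r ch ↔ (e = ([], (c, r)) ∨
      ∃ (j : Fin k) (S : Finset (List (Fin k) × (Fin m × ℕ))), ch j = some S ∧
        ∃ b : List (Fin k), (b, e.2) ∈ S ∧ e.1 = b ++ [j]))
    (c : Fin m) (r : ℕ) (ch : Fin k → Option (Finset (List (Fin k) × (Fin m × ℕ)))) (e : (List (Fin k) × (Fin m × ℕ))) (he : e ∈ asm c r ch) :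
    (e.1 = [] ∧ e.2 = (c, r)) ∨ ∃ (j : Fin k) (S : Finset (List (Fin k) × (Fin m × ℕ))) (b : List (Fin k)),
      ch j = some S ∧ (b, e.2) ∈ S ∧ e.1 = b ++ [j] := by
  rw [hasm] at he
  rcases he with h | ⟨j, S, hS, b, hb, he1⟩
  · exact Or.inl ⟨by rw [h], by rw [h]⟩
  · exact Or.inr ⟨j, S, b, hS, hb, he1⟩

/-- **The root of `asm c r ch` has a childless slot iff some subtree is absent** (when present
subtrees have roots). -/
theorem sissR_hasNone_asm (asm : Fin m → ℕ → (Fin k → Option (Finset (List (Fin k) × (Fin m × ℕ)))) → Finset (List (Fin k) × (Fin m × ℕ)))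
    (hasm : ∀ (c : Fin m) (r : ℕ) (ch : Fin k → Option (Finset (List (Fin k) × (Fin m × ℕ))))
      (e : (List (Fin k) × (Fin m × ℕ))), e ∈ asm c r ch ↔ (e = ([], (c, r)) ∨
      ∃ (j : Fin k) (S : Finset (List (Fin k) × (Fin m × ℕ))), ch j = some S ∧
        ∃ b : List (Fin k), (b, e.2) ∈ S ∧ e.1 = b ++ [j]))
    (c : Fin m) (r : ℕ) (ch : Fin k → Option (Finset (List (Fin k) × (Fin m × ℕ))))
    (hroot : ∀ (j : Fin k) (S : Finset (List (Fin k) × (Fin m × ℕ))), ch j = some S → ∃ lab : Fin m × ℕ, (([] : List (Fin k)), lab) ∈ S) :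
    (∃ j : Fin k, ∀ lab : Fin m × ℕ, ([j], lab) ∉ asm c r ch) ↔ ∃ j : Fin k, ch j = none := by
  constructor
  · rintro ⟨j, hj⟩
    refine ⟨j, ?_⟩
    cases hS : ch j with
    | none => rfl
    | some S =>
      obtain ⟨lab, hlab⟩ := hroot j S hS
      exact absurd ((sissR_asm_mem_single asm hasm c r ch j lab).2 ⟨S, hS, hlab⟩) (hj lab)
  · rintro ⟨j, hj⟩
    refine ⟨j, fun lab hlab => ?_⟩
    obtain ⟨S, hS, _⟩ := (sissR_asm_mem_single asm hasm c r ch j lab).1 hlab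
    rw [hj] at hS
    exact absurd hS (by simp)

/-- **Syntactic validity of an assembled code.** If the root's signs are positive exactly at the slots
carrying a subtree, every subtree is syntactically valid with a root, and every edge equation holds
(the variable of the root slot `j` equals the variable of the least childless root slot of `ch j`),
then `asm c r ch` is syntactically valid. -/
theorem sissR_synv_asm (asm : Fin m → ℕ → (Fin k → Option (Finset (List (Fin k) × (Fin m × ℕ)))) → Finset (List (Fin k) × (Fin m × ℕ)))
    (hasm : ∀ (c : Fin m) (r : ℕ) (ch : Fin k → Option (Finset (List (Fin k) × (Fin m × ℕ))))
      (e : (List (Fin k) × (Fin m × ℕ))), e ∈ asm c r ch ↔ (e = ([], (c, r)) ∨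
      ∃ (j : Fin k) (S : Finset (List (Fin k) × (Fin m × ℕ))), ch j = some S ∧
        ∃ b : List (Fin k), (b, e.2) ∈ S ∧ e.1 = b ++ [j]))
    (Φ : Fin m → Fin k → Fin n × Bool) (c : Fin m) (r : ℕ) (ch : Fin k → Option (Finset (List (Fin k) × (Fin m × ℕ))))
    (hsign : ∀ j : Fin k, (Φ c j).2 = true ↔ ∃ S : Finset (List (Fin k) × (Fin m × ℕ)), ch j = some S)
    (hfun : ∀ (j : Fin k) (S : Finset (List (Fin k) × (Fin m × ℕ))), ch j = some S → ∀ lab lab' : Fin m × ℕ,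
      (([] : List (Fin k)), lab) ∈ S → (([] : List (Fin k)), lab') ∈ S → lab = lab')
    (hch : ∀ (j : Fin k) (S : Finset (List (Fin k) × (Fin m × ℕ))), ch j = some S →
      (∀ e ∈ S, ∀ j : Fin k,
      (((Φ e.2.1 j).2 = true ↔ ∃ lab : Fin m × ℕ, (j :: e.1, lab) ∈ S) ∧
      ∀ (y : Fin m) (s : ℕ), (j :: e.1, (y, s)) ∈ S → ∃ j' : Fin k,
        (∀ lab : Fin m × ℕ, (j' :: j :: e.1, lab) ∉ S) ∧
        (∀ j'' : Fin k, j'' < j' → ∃ lab : Fin m × ℕ, (j'' :: j :: e.1, lab) ∈ S) ∧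
        (Φ e.2.1 j).1 = (Φ y j').1)) ∧
      ∃ (y : Fin m) (s : ℕ), (([] : List (Fin k)), (y, s)) ∈ S ∧ ∃ j' : Fin k,
        (∀ lab : Fin m × ℕ, ([j'], lab) ∉ S) ∧
        (∀ j'' : Fin k, j'' < j' → ∃ lab : Fin m × ℕ, ([j''], lab) ∈ S) ∧
        (Φ c j).1 = (Φ y j').1) :
    ∀ e ∈ asm c r ch, ∀ j : Fin k,
      (((Φ e.2.1 j).2 = true ↔ ∃ lab : Fin m × ℕ, (j :: e.1, lab) ∈ asm c r ch) ∧
      ∀ (y : Fin m) (s : ℕ), (j :: e.1, (y, s)) ∈ asm c r ch → ∃ j' : Fin k,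
        (∀ lab : Fin m × ℕ, (j' :: j :: e.1, lab) ∉ asm c r ch) ∧
        (∀ j'' : Fin k, j'' < j' → ∃ lab : Fin m × ℕ, (j'' :: j :: e.1, lab) ∈ asm c r ch) ∧
        (Φ e.2.1 j).1 = (Φ y j').1) := by
  intro e he j₁
  obtain ⟨a, lab₀⟩ := e
  rcases sissR_asm_cases asm hasm c r ch _ he with ⟨ha, hl⟩ | ⟨j, S, b, hS, hb, hab⟩
  · -- the root
    simp only at ha hl
    subst ha; subst hl
    constructor
    · rw [hsign j₁]
      constructor
      · rintro ⟨S, hS⟩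
        obtain ⟨_, y, s, hys, _⟩ := hch j₁ S hS
        exact ⟨(y, s), (sissR_asm_mem_single asm hasm c r ch j₁ (y, s)).2 ⟨S, hS, hys⟩⟩
      · rintro ⟨lab, hlab⟩
        obtain ⟨S, hS, _⟩ := (sissR_asm_mem_single asm hasm c r ch j₁ lab).1 hlab
        exact ⟨S, hS⟩
    · intro y s hys
      obtain ⟨S, hS, hys'⟩ := (sissR_asm_mem_single asm hasm c r ch j₁ (y, s)).1 hys
      obtain ⟨_, y₀, s₀, hy₀, j', hno, hlt, heq⟩ := hch j₁ S hS
      have hyy : (y, s) = (y₀, s₀) := hfun j₁ S hS _ _ hys' hy₀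
      rw [Prod.mk.injEq] at hyy
      obtain ⟨rfl, rfl⟩ := hyy
      refine ⟨j', fun lab hlab => ?_, fun j'' hj'' => ?_, heq⟩
      · rw [show (j' :: [j₁] : List (Fin k)) = j' :: ([] ++ [j₁]) from rfl,
          sissR_asm_mem_cons_concat asm hasm] at hlab
        obtain ⟨S', hS', h'⟩ := hlab
        rw [hS] at hS'
        cases hS'
        exact hno lab h'
      · obtain ⟨lab, hlab⟩ := hlt j'' hj''
        refine ⟨lab, ?_⟩
        rw [show (j'' :: [j₁] : List (Fin k)) = j'' :: ([] ++ [j₁]) from rfl,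
          sissR_asm_mem_cons_concat asm hasm]
        exact ⟨S, hS, hlab⟩
  · -- a shifted element `(b ++ [j], lab₀)` of the subtree `S`
    simp only at hb hab
    subst hab
    obtain ⟨hsynS, _⟩ := hch j S hS
    obtain ⟨hsgn, hchild⟩ := hsynS (b, lab₀) hb j₁
    constructor
    · rw [hsgn]
      constructor
      · rintro ⟨lab, hlab⟩
        exact ⟨lab, (sissR_asm_mem_cons_concat asm hasm c r ch b j j₁ lab).2 ⟨S, hS, hlab⟩⟩
      · rintro ⟨lab, hlab⟩
        obtain ⟨S', hS', h'⟩ := (sissR_asm_mem_cons_concat asm hasm c r ch b j j₁ lab).1 hlab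
        rw [hS] at hS'
        cases hS'
        exact ⟨lab, h'⟩
    · intro y s hys
      obtain ⟨S', hS', hys'⟩ := (sissR_asm_mem_cons_concat asm hasm c r ch b j j₁ (y, s)).1 hys
      rw [hS] at hS'
      cases hS'
      obtain ⟨j', hno, hlt, heq⟩ := hchild y s hys'
      refine ⟨j', fun lab hlab => ?_, fun j'' hj'' => ?_, heq⟩
      · rw [show (j' :: j₁ :: (b ++ [j]) : List (Fin k)) = j' :: ((j₁ :: b) ++ [j]) from rfl,
          sissR_asm_mem_cons_concat asm hasm] at hlab
        obtain ⟨S', hS', h'⟩ := hlab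
        rw [hS] at hS'
        cases hS'
        exact hno lab h'
      · obtain ⟨lab, hlab⟩ := hlt j'' hj''
        refine ⟨lab, ?_⟩
        rw [show (j'' :: j₁ :: (b ++ [j]) : List (Fin k)) = j'' :: ((j₁ :: b) ++ [j]) from rfl,
          sissR_asm_mem_cons_concat asm hasm]
        exact ⟨S, hS, hlab⟩

/-- **Local validity of an assembled code.** If every subtree `ch j = some S` is locally valid, has a
childless root slot and a unique root of round `< r`, and the root satisfies recency-or-fullness
(`r ≥ 1` implies: some subtree has root round `r - 1`, or all `k` subtrees are present), then
`asm c r ch` is locally valid. -/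
theorem sissR_locv_asm_of (asm : Fin m → ℕ → (Fin k → Option (Finset (List (Fin k) × (Fin m × ℕ)))) → Finset (List (Fin k) × (Fin m × ℕ)))
    (hasm : ∀ (c : Fin m) (r : ℕ) (ch : Fin k → Option (Finset (List (Fin k) × (Fin m × ℕ))))
      (e : (List (Fin k) × (Fin m × ℕ))), e ∈ asm c r ch ↔ (e = ([], (c, r)) ∨
      ∃ (j : Fin k) (S : Finset (List (Fin k) × (Fin m × ℕ))), ch j = some S ∧
        ∃ b : List (Fin k), (b, e.2) ∈ S ∧ e.1 = b ++ [j]))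
    (c : Fin m) (r : ℕ) (ch : Fin k → Option (Finset (List (Fin k) × (Fin m × ℕ))))
    (hfun : ∀ (j : Fin k) (S : Finset (List (Fin k) × (Fin m × ℕ))), ch j = some S → ∀ lab lab' : Fin m × ℕ,
      (([] : List (Fin k)), lab) ∈ S → (([] : List (Fin k)), lab') ∈ S → lab = lab')
    (hch : ∀ (j : Fin k) (S : Finset (List (Fin k) × (Fin m × ℕ))), ch j = some S →
      ((∀ e ∈ S, ∀ (j : Fin k) (y : Fin m) (s : ℕ), (j :: e.1, (y, s)) ∈ S →
        s < e.2.2 ∧ ∃ j' : Fin k, ∀ lab : Fin m × ℕ, (j' :: j :: e.1, lab) ∉ S) ∧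
      (∀ e ∈ S, 1 ≤ e.2.2 → (∃ (j : Fin k) (y : Fin m), (j :: e.1, (y, e.2.2 - 1)) ∈ S) ∨
        (e.1 = [] ∧ ∀ j : Fin k, ∃ lab : Fin m × ℕ, ([j], lab) ∈ S))) ∧ (∃ j : Fin k, ∀ lab : Fin m × ℕ, ([j], lab) ∉ S) ∧
      ∃ (y : Fin m) (s : ℕ), (([] : List (Fin k)), (y, s)) ∈ S ∧ s < r)
    (hrec : 1 ≤ r → (∃ (j : Fin k) (S : Finset (List (Fin k) × (Fin m × ℕ))) (y : Fin m), ch j = some S ∧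
        (([] : List (Fin k)), (y, r - 1)) ∈ S) ∨
      ∀ j : Fin k, ∃ (S : Finset (List (Fin k) × (Fin m × ℕ))) (lab : Fin m × ℕ), ch j = some S ∧ (([] : List (Fin k)), lab) ∈ S) :
    (∀ e ∈ asm c r ch, ∀ (j : Fin k) (y : Fin m) (s : ℕ), (j :: e.1, (y, s)) ∈ asm c r ch →
        s < e.2.2 ∧ ∃ j' : Fin k, ∀ lab : Fin m × ℕ, (j' :: j :: e.1, lab) ∉ asm c r ch) ∧
      (∀ e ∈ asm c r ch, 1 ≤ e.2.2 → (∃ (j : Fin k) (y : Fin m), (j :: e.1, (y, e.2.2 - 1)) ∈ asm c r ch) ∨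
        (e.1 = [] ∧ ∀ j : Fin k, ∃ lab : Fin m × ℕ, ([j], lab) ∈ asm c r ch)) := by
  constructor
  · intro e he j₁ y s hys
    obtain ⟨a, lab₀⟩ := e
    rcases sissR_asm_cases asm hasm c r ch _ he with ⟨ha, hl⟩ | ⟨j, S, b, hS, hb, hab⟩
    · -- child of the root
      simp only at ha hl
      subst ha; subst hl
      obtain ⟨S, hS, hys'⟩ := (sissR_asm_mem_single asm hasm c r ch j₁ (y, s)).1 hys
      obtain ⟨_, ⟨j', hj'⟩, y₀, s₀, hy₀, hs₀⟩ := hch j₁ S hS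
      have hyy : (y, s) = (y₀, s₀) := hfun j₁ S hS _ _ hys' hy₀
      rw [Prod.mk.injEq] at hyy
      obtain ⟨rfl, rfl⟩ := hyy
      refine ⟨hs₀, j', fun lab hlab => ?_⟩
      rw [show (j' :: [j₁] : List (Fin k)) = j' :: ([] ++ [j₁]) from rfl,
        sissR_asm_mem_cons_concat asm hasm] at hlab
      obtain ⟨S', hS', h'⟩ := hlab
      rw [hS] at hS'
      cases hS'
      exact hj' lab h'
    · -- child of a shifted element
      simp only at hb hab hys
      subst hab
      obtain ⟨S', hS', hys'⟩ := (sissR_asm_mem_cons_concat asm hasm c r ch b j j₁ (y, s)).1 hys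
      rw [hS] at hS'
      cases hS'
      obtain ⟨⟨hloc1, _⟩, _⟩ := hch j S hS
      obtain ⟨hs, j', hj'⟩ := hloc1 (b, lab₀) hb j₁ y s hys'
      refine ⟨hs, j', fun lab hlab => ?_⟩
      rw [show (j' :: j₁ :: (b ++ [j]) : List (Fin k)) = j' :: ((j₁ :: b) ++ [j]) from rfl,
        sissR_asm_mem_cons_concat asm hasm] at hlab
      obtain ⟨S', hS', h'⟩ := hlab
      rw [hS] at hS'
      cases hS'
      exact hj' lab h'
  · intro e he h1
    obtain ⟨a, lab₀⟩ := e
    rcases sissR_asm_cases asm hasm c r ch _ he with ⟨ha, hl⟩ | ⟨j, S, b, hS, hb, hab⟩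
    · -- the root: recency or fullness
      simp only at ha hl
      subst ha; subst hl
      rcases hrec h1 with ⟨j, S, y, hS, hy⟩ | hall
      · left
        exact ⟨j, y, (sissR_asm_mem_single asm hasm c r ch j (y, r - 1)).2 ⟨S, hS, hy⟩⟩
      · right
        refine ⟨rfl, fun j => ?_⟩
        obtain ⟨S, lab, hS, hlab⟩ := hall j
        exact ⟨lab, (sissR_asm_mem_single asm hasm c r ch j lab).2 ⟨S, hS, hlab⟩⟩
    · -- a shifted element: recency inside the subtree (fullness is excluded by a childless slot)
      simp only at hb hab h1
      subst hab
      obtain ⟨⟨_, hloc2⟩, ⟨j₀, hj₀⟩, _⟩ := hch j S hS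
      rcases hloc2 (b, lab₀) hb h1 with ⟨j₁, y, hy⟩ | ⟨hbnil, hall⟩
      · left
        exact ⟨j₁, y, (sissR_asm_mem_cons_concat asm hasm c r ch b j j₁ (y, lab₀.2 - 1)).2 ⟨S, hS, hy⟩⟩
      · exfalso
        obtain ⟨lab, hlab⟩ := hall j₀
        exact hj₀ lab hlab

/-- **Local validity of an assembled code, conversely.** If `asm c r ch` is locally valid and the
present subtrees have unique roots, then every subtree is locally valid with a childless root slot
and root round `< r`, and the root satisfies recency-or-fullness. -/
theorem sissR_locv_asm_imp (asm : Fin m → ℕ → (Fin k → Option (Finset (List (Fin k) × (Fin m × ℕ)))) → Finset (List (Fin k) × (Fin m × ℕ)))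
    (hasm : ∀ (c : Fin m) (r : ℕ) (ch : Fin k → Option (Finset (List (Fin k) × (Fin m × ℕ))))
      (e : (List (Fin k) × (Fin m × ℕ))), e ∈ asm c r ch ↔ (e = ([], (c, r)) ∨
      ∃ (j : Fin k) (S : Finset (List (Fin k) × (Fin m × ℕ))), ch j = some S ∧
        ∃ b : List (Fin k), (b, e.2) ∈ S ∧ e.1 = b ++ [j]))
    (c : Fin m) (r : ℕ) (ch : Fin k → Option (Finset (List (Fin k) × (Fin m × ℕ))))
    (hroot : ∀ (j : Fin k) (S : Finset (List (Fin k) × (Fin m × ℕ))), ch j = some S → ∃ lab : Fin m × ℕ, (([] : List (Fin k)), lab) ∈ S)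
    (hloc : (∀ e ∈ asm c r ch, ∀ (j : Fin k) (y : Fin m) (s : ℕ), (j :: e.1, (y, s)) ∈ asm c r ch →
        s < e.2.2 ∧ ∃ j' : Fin k, ∀ lab : Fin m × ℕ, (j' :: j :: e.1, lab) ∉ asm c r ch) ∧
      (∀ e ∈ asm c r ch, 1 ≤ e.2.2 → (∃ (j : Fin k) (y : Fin m), (j :: e.1, (y, e.2.2 - 1)) ∈ asm c r ch) ∨
        (e.1 = [] ∧ ∀ j : Fin k, ∃ lab : Fin m × ℕ, ([j], lab) ∈ asm c r ch))) :
    (∀ (j : Fin k) (S : Finset (List (Fin k) × (Fin m × ℕ))), ch j = some S →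
      ((∀ e ∈ S, ∀ (j : Fin k) (y : Fin m) (s : ℕ), (j :: e.1, (y, s)) ∈ S →
        s < e.2.2 ∧ ∃ j' : Fin k, ∀ lab : Fin m × ℕ, (j' :: j :: e.1, lab) ∉ S) ∧
      (∀ e ∈ S, 1 ≤ e.2.2 → (∃ (j : Fin k) (y : Fin m), (j :: e.1, (y, e.2.2 - 1)) ∈ S) ∨
        (e.1 = [] ∧ ∀ j : Fin k, ∃ lab : Fin m × ℕ, ([j], lab) ∈ S))) ∧ (∃ j : Fin k, ∀ lab : Fin m × ℕ, ([j], lab) ∉ S) ∧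
      ∀ (y : Fin m) (s : ℕ), (([] : List (Fin k)), (y, s)) ∈ S → s < r) ∧
    (1 ≤ r → (∃ (j : Fin k) (S : Finset (List (Fin k) × (Fin m × ℕ))) (y : Fin m), ch j = some S ∧
        (([] : List (Fin k)), (y, r - 1)) ∈ S) ∨ ∀ j : Fin k, ch j ≠ none) := by
  obtain ⟨hloc1, hloc2⟩ := hloc
  have hrootmem : (([] : List (Fin k)), (c, r)) ∈ asm c r ch :=
    (sissR_asm_mem_nil asm hasm c r ch (c, r)).2 rfl
  constructor
  · intro j S hS
    refine ⟨⟨?_, ?_⟩, ?_, ?_⟩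
    · intro e he j₁ y s hys
      have he' : (e.1 ++ [j], e.2) ∈ asm c r ch :=
        (sissR_asm_mem_concat asm hasm c r ch e.1 j e.2).2 ⟨S, hS, he⟩
      have hys' : (j₁ :: (e.1 ++ [j]), (y, s)) ∈ asm c r ch :=
        (sissR_asm_mem_cons_concat asm hasm c r ch e.1 j j₁ (y, s)).2 ⟨S, hS, hys⟩
      obtain ⟨hs, j', hj'⟩ := hloc1 _ he' j₁ y s hys'
      refine ⟨hs, j', fun lab hlab => hj' lab ?_⟩
      rw [show (j' :: j₁ :: (e.1 ++ [j]) : List (Fin k)) = j' :: ((j₁ :: e.1) ++ [j]) from rfl,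
        sissR_asm_mem_cons_concat asm hasm]
      exact ⟨S, hS, hlab⟩
    · intro e he h1
      have he' : (e.1 ++ [j], e.2) ∈ asm c r ch :=
        (sissR_asm_mem_concat asm hasm c r ch e.1 j e.2).2 ⟨S, hS, he⟩
      rcases hloc2 _ he' h1 with ⟨j₁, y, hy⟩ | ⟨hnil, _⟩
      · left
        obtain ⟨S', hS', hy'⟩ := (sissR_asm_mem_cons_concat asm hasm c r ch e.1 j j₁ _).1 hy
        rw [hS] at hS'
        cases hS'
        exact ⟨j₁, y, hy'⟩
      · exact absurd hnil (sissR_concat_ne_nil e.1 j)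
    · -- a childless root slot of `S`
      obtain ⟨lab, hlab⟩ := hroot j S hS
      have hch1 : ([j], lab) ∈ asm c r ch := (sissR_asm_mem_single asm hasm c r ch j lab).2 ⟨S, hS, hlab⟩
      obtain ⟨_, j', hj'⟩ := hloc1 _ hrootmem j lab.1 lab.2 hch1
      refine ⟨j', fun lab' hlab' => hj' lab' ?_⟩
      rw [show (j' :: [j] : List (Fin k)) = j' :: ([] ++ [j]) from rfl, sissR_asm_mem_cons_concat asm hasm]
      exact ⟨S, hS, hlab'⟩
    · -- root round `< r`
      intro y s hys
      have hch1 : ([j], (y, s)) ∈ asm c r ch :=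
        (sissR_asm_mem_single asm hasm c r ch j (y, s)).2 ⟨S, hS, hys⟩
      exact (hloc1 _ hrootmem j y s hch1).1
  · intro h1
    rcases hloc2 _ hrootmem h1 with ⟨j, y, hy⟩ | ⟨_, hall⟩
    · left
      obtain ⟨S, hS, hy'⟩ := (sissR_asm_mem_single asm hasm c r ch j (y, r - 1)).1 hy
      exact ⟨j, S, y, hS, hy'⟩
    · right
      intro j hj
      obtain ⟨lab, hlab⟩ := hall j
      obtain ⟨S, hS, _⟩ := (sissR_asm_mem_single asm hasm c r ch j lab).1 hlab
      rw [hj] at hS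
      exact absurd hS (by simp)

end TreeCompose

end Summit.PneNP.PneNP.Theorems
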